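import Literature.NumberTheory.Automorphic.LocalComponentBJProofs
import Literature.NumberTheory.Automorphic.LangAutomorphicForms
import Literature.NumberTheory.Automorphic.GKModulesProofs
import Literature.NumberTheory.Automorphic.GKModulesAdmissible
import Literature.NumberTheory.Automorphic.AdelicAdditiveCharacter
import Literature.NumberTheory.Automorphic.GLnAdelicStructureProofs
import Literature.NumberTheory.Automorphic.AutomorphicFormsGLContinuous
import HarnessLib

/-!
# Existence of local components of Borel–Jacquet automorphic representations of `GL_n(𝔸_K)`,
# from admissibility (reduction of `AutomorphicRepData.exists_hasLocalComponentAt`)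

Topic `NumberTheory/Automorphic`; second sibling proof file of
`Literature.NumberTheory.Automorphic.LocalComponentBJ` (after `LocalComponentBJProofs`), concerning
its named fact

* `AutomorphicRepData.exists_hasLocalComponentAt n K hcpt` (Flath, Corvallis 1979, Thm. 3 and
  Thm. 4; Bump 1997, Thm. 3.3.3): every automorphic representation `π = W / W'` of `GL_n(𝔸_K)` in
  the sense of Borel–Jacquet (`AutomorphicRepData (AutomorphyDatum.gl n K hcpt)`) has at every
  finite place `v` an irreducible smooth local component, i.e. (`HasLocalComponentAt`) there is an
  irreducible smooth representation `π_v` of `GL_n(K_v)` with a non-zero `GL_n(K_v)`-map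
  `π_v → W / W'` — equivalently, the restriction of `W / W'` to `GL_n(K_v)` (embedded by
  `GLn.ofLocal`) has an irreducible smooth SUBrepresentation.

## Main result

* `AutomorphicRepData.exists_hasLocalComponentAt_of_isAdmissible` (**proved**):
  `automorphicRep_isAdmissible hcpt → exists_hasLocalComponentAt n K hcpt`. The hypothesis is the
  named fact of `LangAutomorphicForms` (Borel–Jacquet 1979, 4.5: `GL_n(𝔸_K^∞)` acts smoothly on
  `W / W'` and `(W / W')^U` has finite `K_∞`-multiplicities for every level `U`; in print a
  consequence of Harish-Chandra's finiteness theorem, 4.3 (i)), which is thereby the whole trust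
  base of `exists_hasLocalComponentAt`. Admissibility is exactly the hypothesis of Flath's theorem
  ("an irreducible *admissible* representation of `G(𝔸)` is factorisable"); without a finiteness
  input a smooth representation need not have irreducible subrepresentations at all.

## The proof (no tensor product theorem)

Write `Q = W / W'`, `σ` for the action of `G_v = GL_n(K_v)` on `Q` along `ι_v` and `𝓔` for the
operators `r(c)` (`c` finite-adelic with `c_v = 1`), `r(k)` (`k ∈ K_∞`), `X ∈ 𝔤` on `Q`; they
commute with `σ`, and `Q` has no proper non-zero `σ(G_v)`- and `𝓔`-stable subspace
(`quot_eq_bot_or_eq_top_of_stable` of `LocalComponentBJProofs`: `GL_n(𝔸_K^∞) = ι_v(G_v) · {c_v = 1}`).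

1. `exists_irreducible_stable_of_finiteDimensional_heckeStable` (**abstract; §1**). For a
   subgroup `K ≤ G_v` fixing every vector of `Q` up to finite index and a non-zero
   finite-dimensional space `F ≤ Q^K` stable under the Hecke sums `∑_{K/U} σ(c) σ(g)` (`U` small of
   finite index), `Q` has an irreducible `σ`-stable subspace: a non-zero Hecke-stable `M ≤ F` of
   minimal dimension generates `V₁ = ⟨σ(G_v) M⟩` with `V₁^K = M`; a non-zero stable `N ≤ V₁` has
   `N^K ≠ 0` by the abstract spherical transfer of `LocalComponentBJProofs`
   (`exists_ne_zero_mem_fixedPoints_of_irreducible`, which uses the irreducibility of `Q` under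
   `σ` and `𝓔`), and `N^K ≤ M` is Hecke-stable, so `N^K = M` and `N = V₁` (Bushnell–Henniart 2006,
   4.3, Proposition: `V ↦ V^K`; Bump 1997, Prop. 4.2.3). With smoothness, `(V₁, σ)` is an
   irreducible smooth representation (`isIrreducible_and_isSmooth_subrepresentation`).
2. `exists_finiteDimensional_heckeStable_block` (**abstract; §2**). The block `F`: inside a
   `K_∞`-stable space `QU ≤ Q^K` with admissible `K_∞`-action, stable under the Hecke sums and
   containing a non-zero `K_∞`-finite vector, take an irreducible `K_∞`-type `τ ≤ QU`
   (`exists_minimal_stable_submodule`, `isIrreducible_of_intertwiningMap_injective` of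
   `GKModulesProofs`) and `F = ∑_{f ∈ Hom_{K_∞}(τ, QU)} f(τ)`, finite-dimensional by admissibility
   and Hecke-stable since `f ↦ (∑_{K/U} σ(c)) ∘ σ(g) ∘ f` preserves `Hom_{K_∞}(τ, QU)`.
3. `AutomorphicRepData.exists_admissible_block` (**§3**). The block `QU` for `π`: a form
   `φ ∈ W ∖ W'` is fixed by `{1} × U₁`, `U₁` compact open in `GL_n(𝔸_K^∞)`
   (`exists_isCompact_isOpen_forall_rightTranslation_ofFinite_eq`); `K = U_v = ι_{v,f}⁻¹(U₁) ∩
   GL_n(𝒪_v)` (compact open, `GLn.isCompact_isOpen_localLevel`, with `GLn.continuous_ofLocal`);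
   `QU` = vectors fixed by `σ(U_v)` and by the elements `C` of `{1} × U₁` trivial at `v`; it is
   `K_∞`-stable and Hecke-stable (`kRep_mem_block`, `subgroupQuotientSum_mem_block`: `C` commutes
   with `σ`, `finiteRep_localRep_comm`), contains `[φ] ≠ 0`, and lies in `(W / W')^{U'}` for the
   level `U' = {1} × {u ∈ U₁ | u_v ∈ U_v}` (`exists_mem_localLevel_mul_of_mem_refinedLevel`:
   `h = ι_v(h_v) · (ι_v(h_v)⁻¹ h)`), which is `K_∞`-admissible by `automorphicRep_isAdmissible`;
   admissibility descends to `QU` (`IsAdmissibleGK.of_injective`). Vectors of `Q` are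
   `K_∞`-finite (`finiteDimensional_span_kRep`) and, by the smoothness half of the hypothesis and
   `GLn.continuous_ofLocal`, `σ`-smooth, hence fixed by finite-index subgroups of the compact `U_v`.
4. **Assembly (§4)**: 3, 2, 1 give an irreducible smooth `(V₁, σ|V₁)`, `V₁ ≤ Q`; composing the
   inclusion with a linear section of `W → W / W'` gives the map `f` of `HasLocalComponentAt`
   (values in `W`, not in `W'`, `σ`-equivariant modulo `W'`), as in
   `hasLocalComponentAt_spherical_of_hasSatakeParamAt_holds`.

## Design notes

* Theorems only: no definition, no new named fact, no `sorry`; `σ` is carried as a variable with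
  the hypothesis `hσ : ∀ t, σ t = π.finiteRep ⟨ι_v t, _⟩` (§3) rather than as a definition, and the
  `GL_n`-specific steps are split into small lemmas because elaboration in the
  `AutomorphicRepData (AutomorphyDatum.gl n K hcpt)` context is expensive (each rewrite costs
  ~10⁷ heartbeats).
* What is NOT here: admissibility itself (`automorphicRep_isAdmissible`, equivalently
  Harish-Chandra's finiteness theorem `harishChandra_finiteness` of `LangAutomorphicForms`,
  Borel–Jacquet 4.3 (i)), uniqueness of the local component (`hasLocalComponentAt_unique`, which
  needs the `π_v`-isotypy of `W / W'`, i.e. more of Flath's theorem), and the tensor product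
  theorem.

## References

* D. Flath, *Decomposition of representations into tensor products*, Proc. Sympos. Pure Math. 33
  (Corvallis 1977), Part 1 (1979), 179–183, Thm. 3, Thm. 4 [FlathCorvallis1979].
* A. Borel, H. Jacquet, *Automorphic forms and automorphic representations*, ibid., 189–202,
  §4.2, §4.5, §4.6 [BorelJacquetCorvallis1979].
* D. Bump, *Automorphic forms and representations*, Cambridge (1997), Thm. 3.3.3 (p. 300) and
  §3.4 (tensor product theorem, after Flath), Prop. 4.2.3 [Bump1997].
* C. Bushnell, G. Henniart, *The local Langlands conjecture for GL(2)*, Grundlehren 335 (2006),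
  §4.2–4.3 (`V ↦ V^K`, the idempotents `e_K`) [BushnellHenniart2006].
* N. R. Wallach, *Real Reductive Groups I* (1988), §3.3.1 (admissible modules, isotypic
  components) [WallachRRG1].
-/

open scoped MatrixGroups Matrix Classical
open NumberField NumberField.mixedEmbedding IsDedekindDomain

noncomputable section

namespace Literature.NumberTheory.Automorphic

/-! ### 0. The local embedding `GL_n(K_v) →* GL_n(𝔸_K)`: continuity, local levels, refined levels -/

section Local

variable (n : ℕ) (K : Type) [Field K] [NumberField K] (v : HeightOneSpectrum (𝓞 K))

/-- **The local embedding `ι_v : GL_n(K_v) →* GL_n(𝔸_K)` is continuous** (on matrices it is the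
affine map `M ↦ 1 + ι_v (M - 1)` for the continuous factor inclusion
`ι_v = adeleSingleHom K v : K_v → 𝔸_K` (`continuous_adeleSingleHom`), then `Continuous.units_map`).
Godement–Jacquet, LNM 260, §10 (`GL_n(𝔸_K)` is the restricted product of the `GL_n(K_w)`).
[folklore] -/
theorem GLn.continuous_ofLocal : Continuous (GLn.ofLocal n K v) := by
  refine Continuous.units_map _ ?_
  change Continuous fun M : Matrix (Fin n) (Fin n) (v.adicCompletion K) =>
    (1 : Matrix (Fin n) (Fin n) (AdeleRing (𝓞 K) K)) + (M - 1).map _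
  exact continuous_const.add
    ((continuous_id.sub continuous_const).matrix_map (continuous_adeleSingleHom K v))

variable {n K} in
/-- `ι_v(t) = (1, (ι_v(t))_f)`: the local embedding factors through the finite-adelic one
(`GLn.ofFinite ∘ GLn.sndHom ∘ GLn.ofLocal = GLn.ofLocal`, its archimedean component being `1`).
Godement–Jacquet, LNM 260, §10. [folklore] -/
theorem GLn.ofFinite_sndHom_ofLocal (t : GL (Fin n) (v.adicCompletion K)) :
    GLn.ofFinite n K (GLn.sndHom n K (GLn.ofLocal n K v t)) = GLn.ofLocal n K v t := by
  obtain ⟨u, hu⟩ : ∃ u, GLn.ofFinite n K u = GLn.ofLocal n K v t := GLn.ofLocal_mem_range_ofFinite v t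
  rw [← hu, GLn.sndHom_ofFinite]

/-- The subgroup `U_v = ι_{v,f}⁻¹(U₁) ∩ GL_n(𝒪_v)` of `GL_n(K_v)` cut out by an open subgroup
`U₁ ≤ GL_n(𝔸_K^∞)` is compact and open (`GL_n(𝒪_v)` is compact open, the finite-adelic local
embedding `ι_{v,f} = sndHom ∘ ι_v` is continuous). Bump (1997), §3.3. [folklore] -/
theorem GLn.isCompact_isOpen_localLevel {U₁ : Subgroup (GL (Fin n) (FiniteAdeleRing (𝓞 K) K))}
    (hU₁ : IsOpen (U₁ : Set (GL (Fin n) (FiniteAdeleRing (𝓞 K) K)))) :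
    IsCompact ((U₁.comap ((GLn.sndHom n K).comp (GLn.ofLocal n K v)) ⊓
        valuedCongruenceSubgroup (Fin n) (1 : WithZero (Multiplicative ℤ)) :
          Subgroup (GL (Fin n) (v.adicCompletion K))) : Set (GL (Fin n) (v.adicCompletion K))) ∧
      IsOpen ((U₁.comap ((GLn.sndHom n K).comp (GLn.ofLocal n K v)) ⊓
        valuedCongruenceSubgroup (Fin n) (1 : WithZero (Multiplicative ℤ)) :
          Subgroup (GL (Fin n) (v.adicCompletion K))) : Set (GL (Fin n) (v.adicCompletion K))) := by
  have hopen : IsOpen ((U₁.comap ((GLn.sndHom n K).comp (GLn.ofLocal n K v)) ⊓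
      valuedCongruenceSubgroup (Fin n) (1 : WithZero (Multiplicative ℤ)) :
        Subgroup (GL (Fin n) (v.adicCompletion K))) : Set (GL (Fin n) (v.adicCompletion K))) :=
    (hU₁.preimage (GLn.continuous_sndHom.comp (GLn.continuous_ofLocal n K v))).inter
      (isOpen_valuedCongruenceSubgroup_one n K v)
  exact ⟨(isCompact_valuedCongruenceSubgroup_one n K v).of_isClosed_subset
    (Subgroup.isClosed_of_isOpen _ hopen) Set.inter_subset_right, hopen⟩

end Local

section Level

variable {n : ℕ} {K : Type} [Field K] [NumberField K] {hcpt : isCompact_glFiniteIntegralLevel n K}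

/-- **Every element of the space of automorphic forms of `GL_n` is fixed by a compact open
subgroup of `GL_n(𝔸_K^∞)`** (an open one by `exists_isOpen_forall_rightTranslation_ofFinite_eq`,
intersected with the compact open `GL_n(𝒪̂_K)`). Borel–Jacquet, Corvallis 1979, 4.2 (a).
[cite: BorelJacquetCorvallis1979, §4.2 (a)] -/
theorem exists_isCompact_isOpen_forall_rightTranslation_ofFinite_eq
    {φ : (AdelicGroupData.gl n K).Adelic → ℂ}
    (hφ : φ ∈ automorphicForms (AutomorphyDatum.gl n K hcpt)) :
    ∃ U₁ : Subgroup (GL (Fin n) (FiniteAdeleRing (𝓞 K) K)),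
      IsOpen (U₁ : Set (GL (Fin n) (FiniteAdeleRing (𝓞 K) K))) ∧
        IsCompact (U₁ : Set (GL (Fin n) (FiniteAdeleRing (𝓞 K) K))) ∧
          ∀ u ∈ U₁, rightTranslation (AdelicGroupData.gl n K) (GLn.ofFinite n K u) φ = φ := by
  obtain ⟨U₀, hU₀open, hU₀fix⟩ := exists_isOpen_forall_rightTranslation_ofFinite_eq hφ
  have hopen : IsOpen ((U₀ ⊓ glFiniteIntegralLevel n K :
      Subgroup (GL (Fin n) (FiniteAdeleRing (𝓞 K) K))) : Set (GL (Fin n) (FiniteAdeleRing (𝓞 K) K))) :=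
    hU₀open.inter (isOpen_glFiniteIntegralLevel n K)
  exact ⟨U₀ ⊓ glFiniteIntegralLevel n K, hopen,
    IsCompact.of_isClosed_subset hcpt (Subgroup.isClosed_of_isOpen _ hopen) Set.inter_subset_right,
    fun u hu => hU₀fix u (Subgroup.mem_inf.1 hu).1⟩

/-- **Splitting a refined level at `v`.** Let `U₁ ≤ GL_n(𝔸_K^∞)`, `U_v = ι_{v,f}⁻¹(U₁) ∩ GL_n(𝒪_v)`
and `U' = {1} × {u ∈ U₁ | u_v ∈ U_v}`. Every `h ∈ U'` is `ι_v(t) · c` with `t ∈ U_v` (namely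
`t = h_v`) and `c = ι_v(t)⁻¹ h` a finite-adelic element of `{1} × U₁` trivial at `v`
(`GL_n(𝔸_K^∞) = GL_n(K_v) × GL_n(𝔸_K^{∞,v})`; Godement–Jacquet, LNM 260, §10). [folklore] -/
theorem exists_mem_localLevel_mul_of_mem_refinedLevel
    (v : HeightOneSpectrum (𝓞 K)) (U₁ : Subgroup (GL (Fin n) (FiniteAdeleRing (𝓞 K) K)))
    (h : (AutomorphyDatum.gl n K hcpt).finiteAdelic)
    (hh : (h : (AdelicGroupData.gl n K).Adelic) ∈
      (U₁ ⊓ (U₁.comap ((GLn.sndHom n K).comp (GLn.ofLocal n K v)) ⊓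
          valuedCongruenceSubgroup (Fin n) (1 : WithZero (Multiplicative ℤ))).comap
        (((AdelicGroupData.gl n K).toLocal v).comp (GLn.ofFinite n K))).map (GLn.ofFinite n K)) :
    ∃ t ∈ (U₁.comap ((GLn.sndHom n K).comp (GLn.ofLocal n K v)) ⊓
        valuedCongruenceSubgroup (Fin n) (1 : WithZero (Multiplicative ℤ))),
      ∃ c : (AutomorphyDatum.gl n K hcpt).finiteAdelic,
        (c : (AdelicGroupData.gl n K).Adelic) ∈ U₁.map (GLn.ofFinite n K) ∧
          (AdelicGroupData.gl n K).toLocal v c = 1 ∧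
            h = ⟨GLn.ofLocal n K v t, GLn.ofLocal_mem_range_ofFinite v t⟩ * c := by
  obtain ⟨u, hu, hhu⟩ := hh
  obtain ⟨t, ht⟩ : ∃ t : GL (Fin n) (v.adicCompletion K),
      (AdelicGroupData.gl n K).toLocal v (GLn.ofFinite n K u) = t := ⟨_, rfl⟩
  have htUv : t ∈ (U₁.comap ((GLn.sndHom n K).comp (GLn.ofLocal n K v)) ⊓
      valuedCongruenceSubgroup (Fin n) (1 : WithZero (Multiplicative ℤ))) :=
    ht ▸ (Subgroup.mem_inf.1 hu).2
  let ι : GL (Fin n) (v.adicCompletion K) →* (AdelicGroupData.gl n K).Adelic := GLn.ofLocal n K v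
  have hcfin : (ι t)⁻¹ * (h : (AdelicGroupData.gl n K).Adelic) ∈
      (AutomorphyDatum.gl n K hcpt).finiteAdelic :=
    mul_mem (inv_mem (GLn.ofLocal_mem_range_ofFinite v t)) h.2
  refine ⟨t, htUv, ⟨_, hcfin⟩, ?_, ?_, Subtype.ext (mul_inv_cancel_left _ _).symm⟩
  · refine mul_mem (inv_mem ?_) ?_
    · exact Subgroup.mem_map.2 ⟨_, (Subgroup.mem_inf.1 htUv).1, GLn.ofFinite_sndHom_ofLocal v t⟩
    · exact Subgroup.mem_map.2 ⟨u, (Subgroup.mem_inf.1 hu).1, hhu⟩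
  · change (AdelicGroupData.gl n K).toLocal v ((ι t)⁻¹ * (h : (AdelicGroupData.gl n K).Adelic)) = 1
    have h1 : (AdelicGroupData.gl n K).toLocal v (ι t) = t := GLn.toLocal_ofLocal t
    rw [map_mul, map_inv, h1, ← hhu, ht]
    exact inv_mul_cancel _

end Level

/-! ### 1. Irreducible subrepresentations from a finite-dimensional Hecke-stable block -/

section Abstract

variable {G Q : Type*} [Group G] [AddCommGroup Q] [Module ℂ Q]
  (σ : Representation ℂ G Q) (K : Subgroup G)

/-- A linear operator commuting with `σ(K)` commutes with the sums `∑_{c ∈ K/U} σ(c)`.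
[folklore] -/
theorem subgroupQuotientSum_comm (U : Subgroup K) [U.FiniteIndex] (E : Module.End ℂ Q)
    (hE : ∀ (k : K) (y : Q), E (σ (k : G) y) = σ (k : G) (E y)) (y : Q) :
    E ((∑ᶠ c : K ⧸ U, σ ((c.out : K) : G)) y) = (∑ᶠ c : K ⧸ U, σ ((c.out : K) : G)) (E y) := by
  haveI : Fintype (K ⧸ U) := Fintype.ofFinite _
  rw [finsum_eq_sum_of_fintype, LinearMap.sum_apply, LinearMap.sum_apply, map_sum]
  exact Finset.sum_congr rfl fun c _ => hE _ _

/-- **Irreducible subrepresentations from a finite-dimensional Hecke-stable block.** Let `σ` be a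
complex representation of a group `G` on `Q`, `K ≤ G`, and `𝓔` a set of linear operators
commuting with `σ(G)`, such that `Q` has no `σ(G)`- and `𝓔`-stable subspace other than `⊥` and
`⊤`, and every vector of `Q` is fixed by a subgroup of finite index of `K`. Suppose `F ≠ 0` is a
finite-dimensional space of `K`-fixed vectors which is *Hecke-stable*: for `x ∈ F`, `g ∈ G` and
all small enough `U ≤ K` of finite index, `∑_{c ∈ K/U} σ(c) σ(g) x ∈ F` (these sums are the
Hecke operators `[K : U] e_K σ(g) e_K` on `Q^K`). Then `Q` has a non-zero `σ(G)`-stable subspace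
`V₁` with no `σ(G)`-stable subspace other than `⊥` and `V₁` — an irreducible subrepresentation.
Proof: let `M ≤ F` be a non-zero Hecke-stable subspace of minimal dimension and `V₁` the span of
`σ(G) M`. The `K`-fixed vectors of `V₁` lie in `M` (`[K : U] x = ∑_{K/U} σ(c) x ∈ M` for
`x = ∑ σ(gᵢ) mᵢ` fixed by `K`); a non-zero stable `N ≤ V₁` has a non-zero `K`-fixed vector by the
abstract spherical transfer (`exists_ne_zero_mem_fixedPoints_of_irreducible`), and `N^K ≤ M` is
Hecke-stable, so `N^K = M` by minimality and `N ⊇ V₁`. This is the algebraic mechanism of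
Bushnell–Henniart (2006), 4.3 Proposition (irreducible `V` with `V^K ≠ 0` ↔ simple
`ℋ(G, K)`-modules), run inside the ambient irreducible module `Q` instead of an induced module;
cf. Bump (1997), Prop. 4.2.3. [folklore] -/
theorem exists_irreducible_stable_of_finiteDimensional_heckeStable (𝓔 : Set (Module.End ℂ Q))
    (hEcomm : ∀ E ∈ 𝓔, ∀ g : G, E * σ g = σ g * E)
    (hirr : ∀ P : Submodule ℂ Q, (∀ g : G, ∀ q ∈ P, σ g q ∈ P) →
      (∀ E ∈ 𝓔, ∀ q ∈ P, E q ∈ P) → P = ⊥ ∨ P = ⊤)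
    (hsm : ∀ q : Q, ∃ U : Subgroup K, U.FiniteIndex ∧ ∀ u : K, u ∈ U → σ (u : G) q = q)
    (F : Submodule ℂ Q) [FiniteDimensional ℂ F] (hF0 : F ≠ ⊥)
    (hFK : ∀ x ∈ F, x ∈ σ.fixedPoints K)
    (hF : ∀ x ∈ F, ∀ g : G, ∃ U₀ : Subgroup K, U₀.FiniteIndex ∧ ∀ U : Subgroup K,
      U.FiniteIndex → U ≤ U₀ → (∑ᶠ c : K ⧸ U, σ ((c.out : K) : G)) (σ g x) ∈ F) :
    ∃ V₁ : Submodule ℂ Q, V₁ ≠ ⊥ ∧ (∀ g : G, ∀ x ∈ V₁, σ g x ∈ V₁) ∧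
      ∀ N : Submodule ℂ Q, N ≤ V₁ → (∀ g : G, ∀ x ∈ N, σ g x ∈ N) → N = ⊥ ∨ N = V₁ := by
  classical
  -- Hecke-stability of a subspace (for all small enough `U`)
  let HSt : Submodule ℂ Q → Prop := fun M => ∀ x ∈ M, ∀ g : G, ∃ U₀ : Subgroup K,
    U₀.FiniteIndex ∧ ∀ U : Subgroup K, U.FiniteIndex → U ≤ U₀ →
      (∑ᶠ c : K ⧸ U, σ ((c.out : K) : G)) (σ g x) ∈ M
  -- a non-zero Hecke-stable `M ≤ F` of minimal dimension
  let S : Set (Submodule ℂ Q) := {M | M ≤ F ∧ M ≠ ⊥ ∧ HSt M}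
  have hFS : F ∈ S := ⟨le_rfl, hF0, hF⟩
  let fd : Submodule ℂ Q → ℕ := fun M => Module.finrank ℂ M
  obtain ⟨M, hM⟩ : ∃ M : Submodule ℂ Q, Function.argminOn fd S ⟨F, hFS⟩ = M := ⟨_, rfl⟩
  obtain ⟨hMF, hM0, hMst⟩ : M ∈ S := hM ▸ Function.argminOn_mem fd S ⟨F, hFS⟩
  have hMmin : ∀ M' ∈ S, fd M ≤ fd M' := fun M' hM' => hM ▸ Function.argminOn_le fd S hM'
  haveI : FiniteDimensional ℂ M := Submodule.finiteDimensional_of_le hMF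
  -- `V₁ = span (σ(G) M)`
  let T : Set Q := {y | ∃ g : G, ∃ m ∈ M, y = σ g m}
  let V₁ : Submodule ℂ Q := Submodule.span ℂ T
  have hMV₁ : M ≤ V₁ := fun m hm =>
    Submodule.subset_span ⟨1, m, hm, by rw [map_one, Module.End.one_apply]⟩
  have hV₁σ : ∀ g : G, ∀ x ∈ V₁, σ g x ∈ V₁ := by
    intro g x hx
    refine Submodule.span_induction ?_ ?_ ?_ ?_ hx
    · rintro _ ⟨h, m, hm, rfl⟩
      exact Submodule.subset_span ⟨g * h, m, hm, by rw [map_mul, Module.End.mul_apply]⟩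
    · rw [map_zero]; exact zero_mem _
    · intro a b _ _ ha hb
      rw [map_add]; exact add_mem ha hb
    · intro c a _ ha
      rw [map_smul]; exact Submodule.smul_mem _ _ ha
  -- the sums over `K / U`, `U` small, map `V₁` into `M`
  have hV₁sum : ∀ x ∈ V₁, ∃ U₀ : Subgroup K, U₀.FiniteIndex ∧ ∀ U : Subgroup K,
      U.FiniteIndex → U ≤ U₀ → (∑ᶠ c : K ⧸ U, σ ((c.out : K) : G)) x ∈ M := by
    intro x hx
    refine Submodule.span_induction ?_ ?_ ?_ ?_ hx
    · rintro _ ⟨g, m, hm, rfl⟩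
      exact hMst m hm g
    · exact ⟨⊤, inferInstance, fun U _ _ => by rw [map_zero]; exact zero_mem _⟩
    · rintro a b - - ⟨U₁, hU₁, h₁⟩ ⟨U₂, hU₂, h₂⟩
      haveI := hU₁
      haveI := hU₂
      refine ⟨U₁ ⊓ U₂, inferInstance, fun U hU hle => ?_⟩
      rw [map_add]
      exact add_mem (h₁ U hU (hle.trans inf_le_left)) (h₂ U hU (hle.trans inf_le_right))
    · rintro c a - ⟨U₁, hU₁, h₁⟩
      refine ⟨U₁, hU₁, fun U hU hle => ?_⟩
      rw [map_smul]
      exact Submodule.smul_mem _ _ (h₁ U hU hle)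
  -- hence the `K`-fixed vectors of `V₁` lie in `M`
  have hV₁K : ∀ x ∈ V₁, x ∈ σ.fixedPoints K → x ∈ M := by
    intro x hx hxK
    obtain ⟨U, hU, hkey⟩ := hV₁sum x hx
    haveI := hU
    have h1 := hkey U hU le_rfl
    rw [subgroupQuotientSum_apply_of_mem_fixedPoints σ K U hxK] at h1
    have hcard : (Nat.card (K ⧸ U) : ℂ) ≠ 0 := Nat.cast_ne_zero.2 Nat.card_pos.ne'
    have := M.smul_mem ((Nat.card (K ⧸ U) : ℂ)⁻¹) h1
    rwa [inv_smul_smul₀ hcard] at this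
  refine ⟨V₁, fun h => hM0 (le_bot_iff.1 (h ▸ hMV₁)), hV₁σ, fun N hNV₁ hN => ?_⟩
  rcases eq_or_ne N ⊥ with hN0 | hN0
  · exact Or.inl hN0
  right
  -- a non-zero `K`-fixed vector in `M`, and the spherical transfer
  obtain ⟨m₀, hm₀M, hm₀⟩ := Submodule.exists_mem_ne_zero_of_ne_bot hM0
  have hNsm : ∀ y ∈ N, ∃ U : Subgroup K, U.FiniteIndex ∧ ∀ u : K, u ∈ U → σ (u : G) y = y :=
    fun y _ => hsm y
  obtain ⟨y, hyN, hy0, hyK⟩ := exists_ne_zero_mem_fixedPoints_of_irreducible σ K 𝓔 hEcomm hirr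
    hm₀ (hFK m₀ (hMF hm₀M)) N hN hN0 hNsm
  -- `N^K` is a non-zero Hecke-stable subspace of `M`, hence all of `M`
  let NK : Submodule ℂ Q := N ⊓ σ.fixedPoints K
  have hNKM : NK ≤ M := fun x hx => hV₁K x (hNV₁ hx.1) hx.2
  have hNK0 : NK ≠ ⊥ := fun h => hy0 ((Submodule.mem_bot ℂ).1 (h ▸ (⟨hyN, hyK⟩ : y ∈ NK)))
  have hNKst : HSt NK := by
    intro x hx g
    obtain ⟨U₀, hU₀, hU₀x⟩ := hsm (σ g x)
    refine ⟨U₀, hU₀, fun U hU hle => ⟨?_, ?_⟩⟩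
    · haveI := hU
      exact subgroupQuotientSum_apply_mem σ K U (fun k _ z hz => hN k z hz) (hN g x hx.1)
    · haveI := hU
      exact subgroupQuotientSum_apply_mem_fixedPoints_of_forall σ K U fun u hu => hU₀x u (hle hu)
  have hNKS : NK ∈ S := ⟨hNKM.trans hMF, hNK0, hNKst⟩
  have hNKeq : NK = M := Submodule.eq_of_le_of_finrank_le hNKM (hMmin NK hNKS)
  -- so `M ≤ N` and `V₁ ≤ N`
  have hMN : M ≤ N := fun m hm => (hNKeq ▸ hm : m ∈ NK).1
  refine le_antisymm hNV₁ (Submodule.span_le.2 ?_)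
  rintro _ ⟨g, m, hm, rfl⟩
  exact hN g m (hMN hm)

/-- **From an irreducible stable subspace to an irreducible smooth subrepresentation.** If `σ`
is a representation of a topological group `G` on `Q` all of whose vectors have open
stabilisers, and `V₁ ≠ 0` is a `σ(G)`-stable subspace with no `σ(G)`-stable subspace other than
`⊥` and `V₁`, then the restriction of `σ` to `V₁` is irreducible (Mathlib
`Representation.IsIrreducible`) and smooth. [folklore] -/
theorem isIrreducible_and_isSmooth_subrepresentation [TopologicalSpace G]
    (hsmooth : ∀ q : Q, σ.IsSmoothVector q) (V₁ : Submodule ℂ Q) (hV₁0 : V₁ ≠ ⊥)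
    (hV₁ : ∀ g : G, ∀ x ∈ V₁, σ g x ∈ V₁)
    (hirr : ∀ N : Submodule ℂ Q, N ≤ V₁ → (∀ g : G, ∀ x ∈ N, σ g x ∈ N) → N = ⊥ ∨ N = V₁) :
    (σ.subrepresentation V₁ fun g x hx => hV₁ g x hx).IsIrreducible ∧
      (σ.subrepresentation V₁ fun g x hx => hV₁ g x hx).IsSmooth := by
  set ρ₁ := σ.subrepresentation V₁ fun g x hx => hV₁ g x hx with hρ₁
  haveI : Nontrivial V₁ := Submodule.nontrivial_iff_ne_bot.2 hV₁0
  let j : ρ₁.IntertwiningMap σ := ⟨V₁.subtype, fun g => LinearMap.ext fun x => rfl⟩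
  have hjrange : LinearMap.range j.toLinearMap = V₁ := Submodule.range_subtype V₁
  refine ⟨isIrreducible_of_intertwiningMap_injective σ j Subtype.val_injective ?_, fun x => ?_⟩
  · rw [hjrange]
    exact fun N hN hle => hirr N hle hN
  · have : (ρ₁.stabilizerSubgroup x : Set G) = (σ.stabilizerSubgroup (x : Q) : Set G) := by
      ext g
      simp only [SetLike.mem_coe, Representation.mem_stabilizerSubgroup, hρ₁,
        Representation.subrepresentation_apply, Subtype.ext_iff, LinearMap.coe_restrict_apply]
    rw [Representation.IsSmoothVector, this]
    exact hsmooth x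

end Abstract

/-! ### 2. A finite-dimensional Hecke-stable block from an admissible one -/

section Block

variable {G Q Kc : Type*} [Group G] [AddCommGroup Q] [Module ℂ Q] [Group Kc]
  (σ : Representation ℂ G Q) (K : Subgroup G) (κ : Representation ℂ Kc Q)

/-- **A finite-dimensional Hecke-stable block inside an admissible one.** Let `σ` (of `G`) and
`κ` (of `K_c`, think `K_∞`) be commuting complex representations on `Q`, `K ≤ G` a subgroup
fixing every vector up to finite index, and `QU ≤ Q` a `κ`-stable subspace whose `κ`-action is
admissible (`dim Hom_{K_c}(τ, QU) < ∞` for irreducible finite-dimensional `τ`) and which is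
stable under the sums `∑_{c ∈ K/U} σ(c) σ(g)` (`U ≤ K` of finite index fixing `σ(g) q`). If
`QU` contains a non-zero `κ`-finite vector `q₁`, then it contains a non-zero finite-dimensional
subspace `F` which is Hecke-stable in the sense of
`exists_irreducible_stable_of_finiteDimensional_heckeStable`: the `κ`-span of `q₁` contains an
irreducible `K_c`-type `τ` (a minimal `κ`-stable subspace, `exists_minimal_stable_submodule`),
and `F = ∑_{f ∈ Hom_{K_c}(τ, QU)} f(τ)` is finite-dimensional by admissibility and Hecke-stable
because `f ↦ (∑_{K/U} σ(c)) ∘ σ(g) ∘ f` preserves `Hom_{K_c}(τ, QU)` for `U` small. This is the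
finiteness mechanism of Flath's theorem (Flath, Corvallis 1979, Thm. 3: irreducible *admissible*
modules of a product factor) isolated from the tensor product; cf. Wallach, *Real Reductive
Groups I*, §3.3.1 (isotypic components of admissible modules). [folklore] -/
theorem exists_finiteDimensional_heckeStable_block
    (hcomm : ∀ (k : Kc) (g : G) (q : Q), κ k (σ g q) = σ g (κ k q))
    (hsm : ∀ q : Q, ∃ U : Subgroup K, U.FiniteIndex ∧ ∀ u : K, u ∈ U → σ (u : G) q = q)
    (QU : Submodule ℂ Q) (hQUκ : ∀ k, ∀ q ∈ QU, κ k q ∈ QU)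
    (hQUsum : ∀ (g : G) (q : Q), q ∈ QU → ∀ U : Subgroup K, U.FiniteIndex →
      (∀ u : K, u ∈ U → σ (u : G) (σ g q) = σ g q) →
        (∑ᶠ c : K ⧸ U, σ ((c.out : K) : G)) (σ g q) ∈ QU)
    (hadm : ∀ (W : Type) [AddCommGroup W] [Module ℂ W] [FiniteDimensional ℂ W]
      (τ : Representation ℂ Kc W), τ.IsIrreducible →
        FiniteDimensional ℂ (τ.IntertwiningMap (κ.subrepresentation QU fun k _ hq => hQUκ k _ hq)))
    {q₁ : Q} (hq₁ : q₁ ≠ 0) (hq₁QU : q₁ ∈ QU)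
    (hfin : FiniteDimensional ℂ (Submodule.span ℂ (Set.range fun k : Kc => κ k q₁))) :
    ∃ F : Submodule ℂ Q, FiniteDimensional ℂ F ∧ F ≠ ⊥ ∧ F ≤ QU ∧
      ∀ x ∈ F, ∀ g : G, ∃ U₀ : Subgroup K, U₀.FiniteIndex ∧ ∀ U : Subgroup K,
        U.FiniteIndex → U ≤ U₀ → (∑ᶠ c : K ⧸ U, σ ((c.out : K) : G)) (σ g x) ∈ F := by
  classical
  -- the `κ`-span `E` of `q₁`: finite-dimensional, `κ`-stable, inside `QU`
  let E : Submodule ℂ Q := Submodule.span ℂ (Set.range fun k : Kc => κ k q₁)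
  haveI : FiniteDimensional ℂ E := hfin
  have hEK : ∀ k, ∀ w ∈ E, κ k w ∈ E := by
    intro k w hw
    have hle : E.map (κ k) ≤ E := by
      rw [Submodule.map_span, Submodule.span_le]
      rintro _ ⟨_, ⟨k', rfl⟩, rfl⟩
      refine Submodule.subset_span ⟨k * k', ?_⟩
      change κ (k * k') q₁ = κ k (κ k' q₁)
      rw [map_mul, Module.End.mul_apply]
    exact hle (Submodule.mem_map_of_mem hw)
  have hq₁E : q₁ ∈ E := Submodule.subset_span ⟨1, show κ 1 q₁ = q₁ by rw [map_one, Module.End.one_apply]⟩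
  have hE0 : E ≠ ⊥ := fun h => hq₁ ((Submodule.eq_bot_iff E).mp h q₁ hq₁E)
  have hEQU : E ≤ QU := Submodule.span_le.2 (by
    rintro _ ⟨k, rfl⟩
    exact hQUκ k q₁ hq₁QU)
  -- a minimal `κ`-stable `W₀ ≤ E`: an irreducible `K_c`-type `τ` on `Fin d → ℂ : Type`
  obtain ⟨W₀, hW₀E, hW₀ne, hW₀K, hW₀min⟩ := exists_minimal_stable_submodule κ E hE0 hEK
  haveI : FiniteDimensional ℂ W₀ := Submodule.finiteDimensional_of_le hW₀E
  haveI : Nontrivial W₀ := Submodule.nontrivial_iff_ne_bot.mpr hW₀ne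
  let W₀r : Subrepresentation κ := ⟨W₀, fun k w hw => hW₀K k w hw⟩
  let e : W₀ ≃ₗ[ℂ] (Fin (Module.finrank ℂ W₀) → ℂ) := (Module.finBasis ℂ W₀).equivFun
  let τ : Representation ℂ Kc (Fin (Module.finrank ℂ W₀) → ℂ) :=
    e.conjRingEquiv.toMonoidHom.comp W₀r.toRepresentation
  have hτ : ∀ k y, τ k y = e (W₀r.toRepresentation k (e.symm y)) := fun k y => rfl
  have hτ' : ∀ (k) (w : W₀), ((W₀r.toRepresentation k w : W₀) : Q) = κ k w := fun k w => rfl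
  let j : τ.IntertwiningMap κ :=
    ⟨W₀.subtype ∘ₗ e.symm.toLinearMap, fun k => LinearMap.ext fun y => by
      change ((e.symm (τ k y) : W₀) : Q) = κ k ((e.symm y : W₀) : Q)
      rw [hτ, LinearEquiv.symm_apply_apply, hτ']⟩
  have hjinj : Function.Injective j := fun a b h => e.symm.injective (Subtype.ext h)
  have hjrange : LinearMap.range j.toLinearMap = W₀ := by
    change LinearMap.range (W₀.subtype ∘ₗ e.symm.toLinearMap) = W₀
    rw [LinearMap.range_comp, LinearEquiv.range, Submodule.map_top, Submodule.range_subtype]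
  haveI : Nontrivial (Fin (Module.finrank ℂ W₀) → ℂ) := e.injective.nontrivial
  have hτirr : τ.IsIrreducible :=
    isIrreducible_of_intertwiningMap_injective κ j hjinj (by
      rw [hjrange]
      exact fun U hUK hUle => hW₀min U hUK hUle)
  -- `τ` maps into `QU`; `Hom_{K_c}(τ, QU)` is finite-dimensional (admissibility)
  let ρQU : Representation ℂ Kc QU := κ.subrepresentation QU fun k _ hq => hQUκ k _ hq
  have hW₀QU : W₀ ≤ QU := hW₀E.trans hEQU
  let jτ : τ.IntertwiningMap ρQU :=
    ⟨Submodule.inclusion hW₀QU ∘ₗ e.symm.toLinearMap, fun k => LinearMap.ext fun y =>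
      Subtype.ext (by
        change ((e.symm (τ k y) : W₀) : Q) = κ k ((e.symm y : W₀) : Q)
        rw [hτ, LinearEquiv.symm_apply_apply, hτ'])⟩
  have hjτapply : ∀ y, ((jτ y : QU) : Q) = ((e.symm y : W₀) : Q) := fun y => rfl
  haveI : FiniteDimensional ℂ (τ.IntertwiningMap ρQU) := hadm _ τ hτirr
  -- the block `F = ∑_{f ∈ Hom_{K_c}(τ, QU)} f(τ) ≤ QU`
  let b := Module.finBasis ℂ (Fin (Module.finrank ℂ W₀) → ℂ)
  let ev : Fin (Module.finrank ℂ (Fin (Module.finrank ℂ W₀) → ℂ)) →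
      (τ.IntertwiningMap ρQU →ₗ[ℂ] Q) := fun i =>
    { toFun := fun f => ((f (b i) : QU) : Q)
      map_add' := fun f g => rfl
      map_smul' := fun c f => rfl }
  let F : Submodule ℂ Q := ⨆ i, LinearMap.range (ev i)
  haveI : ∀ i, FiniteDimensional ℂ (LinearMap.range (ev i)) := fun i =>
    LinearMap.finiteDimensional_range (ev i)
  haveI hFfin : FiniteDimensional ℂ F := Submodule.finiteDimensional_iSup _
  have hS : ∀ (f : τ.IntertwiningMap ρQU) (w), ((f w : QU) : Q) ∈ F := by
    intro f w
    rw [← b.sum_repr w, map_sum, Submodule.coe_sum]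
    refine Submodule.sum_mem _ fun i _ => ?_
    rw [map_smul, Submodule.coe_smul]
    exact Submodule.smul_mem _ _ (Submodule.mem_iSup_of_mem i ⟨f, rfl⟩)
  have hFQU : F ≤ QU := iSup_le fun i => by
    rintro _ ⟨f, rfl⟩
    exact (f (b i)).2
  have hF0 : F ≠ ⊥ := by
    obtain ⟨w₀, hw₀, hw₀0⟩ := Submodule.exists_mem_ne_zero_of_ne_bot hW₀ne
    intro hF
    have hmem : ((jτ (e ⟨w₀, hw₀⟩) : QU) : Q) ∈ F := hS jτ _
    rw [hF, Submodule.mem_bot, hjτapply, LinearEquiv.symm_apply_apply] at hmem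
    exact hw₀0 hmem
  refine ⟨F, hFfin, hF0, hFQU, fun x hx g => ?_⟩
  -- Hecke stability: a finite-index `U₀ ≤ K` fixing `σ(g) y` for `y` in a basis of `F`
  let bF := Module.finBasis ℂ F
  choose Uj hUj hUjfix using fun j : Fin (Module.finrank ℂ F) => hsm (σ g (bF j : Q))
  refine ⟨⨅ j, Uj j, Subgroup.finiteIndex_iInf hUj, fun U hU hle => ?_⟩
  haveI := hU
  set SU : Module.End ℂ Q := ∑ᶠ c : K ⧸ U, σ ((c.out : K) : G) with hSU
  -- `σ(g) F` consists of `U`-fixed vectors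
  have hfixF : ∀ y ∈ F, ∀ u : K, u ∈ U → σ (u : G) (σ g y) = σ g y := by
    intro y hy u hu
    have hy' : y = ∑ j, (bF.repr ⟨y, hy⟩ j) • (bF j : Q) := by
      conv_lhs => rw [show y = ((⟨y, hy⟩ : F) : Q) from rfl, ← bF.sum_repr ⟨y, hy⟩]
      rw [Submodule.coe_sum]
      rfl
    rw [hy', map_sum, map_sum]
    refine Finset.sum_congr rfl fun j _ => ?_
    rw [map_smul, map_smul, hUjfix j u ((Subgroup.mem_iInf.1 (hle hu)) j)]
  -- `f ↦ SU ∘ σ(g) ∘ f` preserves `Hom_{K_c}(τ, QU)`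
  have hT : ∀ f : τ.IntertwiningMap ρQU, ∃ T : τ.IntertwiningMap ρQU,
      ∀ w, ((T w : QU) : Q) = SU (σ g ((f w : QU) : Q)) := by
    intro f
    have hmem : ∀ w, SU (σ g ((f w : QU) : Q)) ∈ QU := fun w =>
      hQUsum g _ (f w).2 U hU (hfixF _ (hS f w))
    let Tlin : (Fin (Module.finrank ℂ W₀) → ℂ) →ₗ[ℂ] QU :=
      LinearMap.codRestrict QU (SU ∘ₗ σ g ∘ₗ QU.subtype ∘ₗ f.toLinearMap) fun w => hmem w
    refine ⟨⟨Tlin, fun k => LinearMap.ext fun w => Subtype.ext ?_⟩, fun w => rfl⟩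
    change SU (σ g ((f (τ k w) : QU) : Q)) = κ k (SU (σ g ((f w : QU) : Q)))
    rw [f.isIntertwining]
    change SU (σ g (κ k ((f w : QU) : Q))) = _
    rw [← hcomm k g, subgroupQuotientSum_comm σ K U (κ k) (fun u y => hcomm k u y)]
  -- hence `SU (σ g x) ∈ F`
  refine Submodule.iSup_induction _ (motive := fun y => SU (σ g y) ∈ F) hx ?_ ?_ ?_
  · rintro i _ ⟨f, rfl⟩
    obtain ⟨T, hT'⟩ := hT f
    change SU (σ g ((f (b i) : QU) : Q)) ∈ F
    rw [← hT']
    exact hS T (b i)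
  · rw [map_zero, map_zero]
    exact zero_mem _
  · intro y z hy hz
    rw [map_add, map_add]
    exact add_mem hy hz

end Block

/-! ### 3. The action of `GL_n(K_v)` on `W / W'` and the admissible block at `v` -/

namespace AutomorphicRepData

variable {n : ℕ} {K : Type} [Field K] [NumberField K] {hcpt : isCompact_glFiniteIntegralLevel n K}
  (π : AutomorphicRepData (AutomorphyDatum.gl n K hcpt))

/-- **Vectors of `W / W'` are `K_∞`-finite**: the `K_∞`-translates `r(k) [φ] = [r(k) φ]` of a
class span a finite-dimensional space (automorphic forms are `K_∞`-finite, Borel–Jacquet 1979,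
4.2 (b), and `K`-finiteness is linear, `IsStableSubmodule.isKFinite`). [cite: BorelJacquetCorvallis1979, §4.2 (b)] -/
theorem finiteDimensional_span_kRep (q : π.Quot) :
    FiniteDimensional ℂ (Submodule.span ℂ
      (Set.range fun k : (AutomorphyDatum.gl n K hcpt).arch.maximalCompact => π.kRep k q)) := by
  induction q using Submodule.Quotient.induction_on with
  | H ψ =>
    haveI : FiniteDimensional ℂ (kTranslateSpan (AutomorphyDatum.gl n K hcpt).ofArch (ψ : _ → ℂ)) :=
      π.stable.isKFinite ψ.2
    have hFW : kTranslateSpan (AutomorphyDatum.gl n K hcpt).ofArch (ψ : _ → ℂ) ≤ π.W :=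
      Submodule.span_le.2 (by
        rintro _ ⟨k, rfl⟩
        exact π.stable.k_stable k ψ.2)
    let L : kTranslateSpan (AutomorphyDatum.gl n K hcpt).ofArch (ψ : _ → ℂ) →ₗ[ℂ] π.Quot :=
      π.mkQ ∘ₗ Submodule.inclusion hFW
    refine Submodule.finiteDimensional_of_le (S₂ := LinearMap.range L) (Submodule.span_le.2 ?_)
    rintro _ ⟨k, rfl⟩
    exact ⟨⟨_, archTranslate_mem_kTranslateSpan (AutomorphyDatum.gl n K hcpt).ofArch k _⟩, rfl⟩

section LocalRep

variable (v : HeightOneSpectrum (𝓞 K))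
  (σ : Representation ℂ (GL (Fin n) (v.adicCompletion K)) π.Quot)
  (hσ : ∀ t, σ t = π.finiteRep ⟨GLn.ofLocal n K v t, GLn.ofLocal_mem_range_ofFinite v t⟩)

/-! In this section `σ` is the representation of `GL_n(K_v)` on `W / W'` by right translation
along the local embedding `ι_v` (hypothesis `hσ`, which determines `σ`; in the assembly
`σ = π.finiteRep ∘ ι_v`). -/

include hσ in
/-- `σ(t) [ψ] = [r(ι_v t) ψ]` (`AutomorphicRepData.finiteRep_mk`). Borel–Jacquet 1979, 4.6. [folklore] -/
theorem localRep_mk (t : GL (Fin n) (v.adicCompletion K)) (ψ : π.W) :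
    σ t (Submodule.Quotient.mk ψ) = Submodule.Quotient.mk (p := π.kerQuot)
      ⟨rightTranslation (AdelicGroupData.gl n K) (GLn.ofLocal n K v t) ψ,
        π.stable.finite_stable _ (GLn.ofLocal_mem_range_ofFinite v t) ψ.2⟩ := by
  rw [hσ, π.finiteRep_mk]

include hσ in
/-- **Finite-adelic elements trivial at `v` commute with `σ(GL_n(K_v))`** on `W / W'`
(`GLn.ofLocal_mul_eq_mul_ofLocal_of_toLocal_eq_one`). Godement–Jacquet, LNM 260, §10. [folklore] -/
theorem finiteRep_localRep_comm (c : (AutomorphyDatum.gl n K hcpt).finiteAdelic)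
    (hc : (AdelicGroupData.gl n K).toLocal v c = 1) (t : GL (Fin n) (v.adicCompletion K))
    (q : π.Quot) : π.finiteRep c (σ t q) = σ t (π.finiteRep c q) := by
  have h : (⟨GLn.ofLocal n K v t, GLn.ofLocal_mem_range_ofFinite v t⟩ * c :
      (AutomorphyDatum.gl n K hcpt).finiteAdelic) =
        c * ⟨GLn.ofLocal n K v t, GLn.ofLocal_mem_range_ofFinite v t⟩ :=
    Subtype.ext (GLn.ofLocal_mul_eq_mul_ofLocal_of_toLocal_eq_one t hc)
  have h' := congrArg (fun x => π.finiteRep x q) h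
  simp only [MonoidHom.map_mul, Module.End.mul_apply] at h'
  rw [hσ]
  exact h'.symm

include hσ in
/-- **`K_∞` commutes with `σ(GL_n(K_v))`** on `W / W'` (`kRep_comm_finiteRep`).
Borel–Jacquet 1979, 4.6. [folklore] -/
theorem kRep_localRep_comm (k : (AutomorphyDatum.gl n K hcpt).arch.maximalCompact)
    (t : GL (Fin n) (v.adicCompletion K)) (q : π.Quot) :
    π.kRep k (σ t q) = σ t (π.kRep k q) := by
  rw [hσ]
  exact π.kRep_comm_finiteRep k _ q

include hσ in
/-- **The block of a local level and an away-from-`v` subgroup is `K_∞`-stable**: for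
`U_v ≤ GL_n(K_v)` and `C ≤ GL_n(𝔸_K^∞)` consisting of elements trivial at `v`, the vectors of
`W / W'` fixed by `σ(U_v)` and by `C` are preserved by `K_∞` (which commutes with both).
Borel–Jacquet 1979, 4.6. [folklore] -/
theorem kRep_mem_block (Uv : Subgroup (GL (Fin n) (v.adicCompletion K)))
    (C : Subgroup (AutomorphyDatum.gl n K hcpt).finiteAdelic)
    (k : (AutomorphyDatum.gl n K hcpt).arch.maximalCompact) {q : π.Quot}
    (hq : q ∈ σ.fixedPoints Uv ⊓ π.finiteRep.fixedPoints C) :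
    π.kRep k q ∈ σ.fixedPoints Uv ⊓ π.finiteRep.fixedPoints C := by
  refine Submodule.mem_inf.2
    ⟨(σ.mem_fixedPoints Uv _).2 fun u hu => ?_, (π.finiteRep.mem_fixedPoints C _).2 fun c hc => ?_⟩
  · rw [← π.kRep_localRep_comm v σ hσ, (σ.mem_fixedPoints Uv q).1 (Submodule.mem_inf.1 hq).1 u hu]
  · rw [← π.kRep_comm_finiteRep, (π.finiteRep.mem_fixedPoints C q).1 (Submodule.mem_inf.1 hq).2 c hc]

include hσ in
/-- **The block is stable under the local Hecke sums**: with `U_v`, `C` as in `kRep_mem_block`,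
for `q` in the block, `g ∈ GL_n(K_v)` and `U ≤ U_v` of finite index fixing `σ(g) q`, the sum
`∑_{c ∈ U_v/U} σ(c) σ(g) q` is again fixed by `σ(U_v)` (`subgroupQuotientSum_apply_mem_fixedPoints_of_forall`)
and by `C` (which commutes with `σ`). Bushnell–Henniart (2006), §4.2 (the idempotents `e_K`).
[folklore] -/
theorem subgroupQuotientSum_mem_block (Uv : Subgroup (GL (Fin n) (v.adicCompletion K)))
    (C : Subgroup (AutomorphyDatum.gl n K hcpt).finiteAdelic)
    (hC : ∀ c ∈ C, (AdelicGroupData.gl n K).toLocal v c = 1)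
    (g : GL (Fin n) (v.adicCompletion K)) {q : π.Quot}
    (hq : q ∈ σ.fixedPoints Uv ⊓ π.finiteRep.fixedPoints C) (U : Subgroup Uv) [U.FiniteIndex]
    (hfix : ∀ u : Uv, u ∈ U → σ (u : GL (Fin n) (v.adicCompletion K)) (σ g q) = σ g q) :
    (∑ᶠ c : Uv ⧸ U, σ ((c.out : Uv) : GL (Fin n) (v.adicCompletion K))) (σ g q) ∈
      σ.fixedPoints Uv ⊓ π.finiteRep.fixedPoints C := by
  refine Submodule.mem_inf.2 ⟨subgroupQuotientSum_apply_mem_fixedPoints_of_forall σ Uv U hfix,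
    (π.finiteRep.mem_fixedPoints C _).2 fun c hc => ?_⟩
  rw [subgroupQuotientSum_comm σ Uv U (π.finiteRep c)
      (fun u y => π.finiteRep_localRep_comm v σ hσ c (hC c hc) u y),
    π.finiteRep_localRep_comm v σ hσ c (hC c hc),
    (π.finiteRep.mem_fixedPoints C q).1 (Submodule.mem_inf.1 hq).2 c hc]

include hσ in
/-- **The admissible block at `v`.** Let `π = W / W'` be an automorphic representation of
`GL_n(𝔸_K)` (Borel–Jacquet model) with `GL_n(𝔸_K^∞)` acting smoothly and admissibly on `W / W'`
(`automorphicRep_isAdmissible`), `v` a finite place and `σ` the action of `GL_n(K_v)` on `W / W'`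
by right translation along `ι_v`. Then there are a compact (open) subgroup `U_v ≤ GL_n(K_v)` and a
non-zero `K_∞`-stable subspace `QU` of `U_v`-fixed vectors of `W / W'` on which `K_∞` acts
admissibly and which is stable under the sums `∑_{c ∈ U_v/U} σ(c) σ(g)` (`U ≤ U_v` of finite
index fixing `σ(g) q`). Construction: a form `φ ∈ W ∖ W'` is fixed by `{1} × U₁`, `U₁` compact
open in `GL_n(𝔸_K^∞)`; `U_v = ι_v⁻¹(U₁) ∩ GL_n(𝒪_v)`; `QU` = the vectors fixed by `ι_v(U_v)` and by
the elements of `{1} × U₁` trivial at `v`; `QU` lies in `(W / W')^{U'}` for the level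
`U' = {1} × {u ∈ U₁ | u_v ∈ U_v}` (`exists_mem_localLevel_mul_of_mem_refinedLevel`), which is
admissible by hypothesis, and admissibility passes to `K_∞`-submodules
(`IsAdmissibleGK.of_injective`). Borel–Jacquet 1979, 4.5–4.6; Flath 1979, Thm. 3 (where the
admissibility of the irreducible module is the hypothesis). [cite: BorelJacquetCorvallis1979, §4.6] -/
theorem exists_admissible_block (hadm : automorphicRep_isAdmissible hcpt) :
    ∃ (Uv : Subgroup (GL (Fin n) (v.adicCompletion K))) (QU : Submodule ℂ π.Quot)
      (hQUk : ∀ k, ∀ q ∈ QU, π.kRep k q ∈ QU),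
      IsCompact (Uv : Set (GL (Fin n) (v.adicCompletion K))) ∧ QU ≠ ⊥ ∧
      QU ≤ σ.fixedPoints Uv ∧
      IsAdmissibleGK (Representation.subrepresentation π.kRep QU fun k _ hq => hQUk k _ hq) ∧
      ∀ (g : GL (Fin n) (v.adicCompletion K)) (q : π.Quot), q ∈ QU →
        ∀ U : Subgroup Uv, U.FiniteIndex →
          (∀ u : Uv, u ∈ U → σ (u : GL (Fin n) (v.adicCompletion K)) (σ g q) = σ g q) →
          (∑ᶠ c : Uv ⧸ U, σ ((c.out : Uv) : GL (Fin n) (v.adicCompletion K))) (σ g q) ∈ QU := by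
  -- a form `φ ∈ W ∖ W'` and a compact open `U₁ ≤ GL_n(𝔸_K^∞)` fixing it
  obtain ⟨φ, hφW, hφW'⟩ := SetLike.exists_of_lt π.lt
  obtain ⟨U₁, hU₁open, hU₁cpt, hU₁fix⟩ :=
    exists_isCompact_isOpen_forall_rightTranslation_ofFinite_eq (π.stable.le_automorphicForms hφW)
  -- the compact open subgroup `U_v = ι_{v,f}⁻¹(U₁) ∩ GL_n(𝒪_v)` of `GL_n(K_v)`
  let Uv : Subgroup (GL (Fin n) (v.adicCompletion K)) :=
    U₁.comap ((GLn.sndHom n K).comp (GLn.ofLocal n K v)) ⊓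
      valuedCongruenceSubgroup (Fin n) (1 : WithZero (Multiplicative ℤ))
  obtain ⟨hUvcpt, hUvopen⟩ := GLn.isCompact_isOpen_localLevel n K v hU₁open
  -- the refined level `U' = {1} × {u ∈ U₁ | u_v ∈ U_v}` and its admissibility
  let toLocF : GL (Fin n) (FiniteAdeleRing (𝓞 K) K) →* GL (Fin n) (v.adicCompletion K) :=
    ((AdelicGroupData.gl n K).toLocal v).comp (GLn.ofFinite n K)
  have htoLocF : Continuous toLocF :=
    ((AdelicGroupData.gl n K).continuous_toLocal v).comp (GLn.continuous_ofFinite n K)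
  let U₀' : Subgroup (GL (Fin n) (FiniteAdeleRing (𝓞 K) K)) := U₁ ⊓ Uv.comap toLocF
  have hU₀'open : IsOpen (U₀' : Set (GL (Fin n) (FiniteAdeleRing (𝓞 K) K))) :=
    hU₁open.inter (hUvopen.preimage htoLocF)
  have hU₀'cpt : IsCompact (U₀' : Set (GL (Fin n) (FiniteAdeleRing (𝓞 K) K))) :=
    hU₁cpt.of_isClosed_subset (U₀'.isClosed_of_isOpen hU₀'open) Set.inter_subset_left
  have hU'mem : U₀'.map (GLn.ofFinite n K) ∈ finiteLevelsGL n K := ⟨U₀', hU₀'open, hU₀'cpt, rfl⟩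
  have hadmU' : IsAdmissibleGK (π.kRepFixed
      ((U₀'.map (GLn.ofFinite n K)).subgroupOf (AutomorphyDatum.gl n K hcpt).finiteAdelic)) :=
    (hadm π).2 _ hU'mem
  -- the finite-adelic elements of `{1} × U₁` trivial at `v`, and the block `QU`
  let C : Subgroup (AutomorphyDatum.gl n K hcpt).finiteAdelic :=
    (U₁.map (GLn.ofFinite n K)).subgroupOf _ ⊓
      (((AdelicGroupData.gl n K).toLocal v).comp (Subgroup.subtype _)).ker
  have hmemC : ∀ c : (AutomorphyDatum.gl n K hcpt).finiteAdelic, c ∈ C ↔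
      (c : (AdelicGroupData.gl n K).Adelic) ∈ U₁.map (GLn.ofFinite n K) ∧
        (AdelicGroupData.gl n K).toLocal v c = 1 := fun c => Iff.rfl
  have hC : ∀ c ∈ C, (AdelicGroupData.gl n K).toLocal v c = 1 := fun c hc => ((hmemC c).1 hc).2
  let QU : Submodule ℂ π.Quot := σ.fixedPoints Uv ⊓ π.finiteRep.fixedPoints C
  have hQUk : ∀ k, ∀ q ∈ QU, π.kRep k q ∈ QU := fun k q hq => π.kRep_mem_block v σ hσ Uv C k hq
  -- `QU` lies in the `U'`-fixed vectors
  have hQU_le : QU ≤ π.finiteRep.fixedPoints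
      ((U₀'.map (GLn.ofFinite n K)).subgroupOf (AutomorphyDatum.gl n K hcpt).finiteAdelic) := by
    intro q hq
    rw [Representation.mem_fixedPoints]
    intro h hh
    obtain ⟨t, htUv, c, hcU₁, hc1, rfl⟩ :=
      exists_mem_localLevel_mul_of_mem_refinedLevel v U₁ h (Subgroup.mem_subgroupOf.1 hh)
    rw [map_mul, Module.End.mul_apply,
      (π.finiteRep.mem_fixedPoints C q).1 (Submodule.mem_inf.1 hq).2 c ((hmemC c).2 ⟨hcU₁, hc1⟩),
      ← hσ]
    exact (σ.mem_fixedPoints Uv q).1 (Submodule.mem_inf.1 hq).1 t htUv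
  -- the vector `q₁ = [φ] ≠ 0` of `QU`
  have hq₁ : π.mkQ ⟨φ, hφW⟩ ≠ 0 := by
    intro h
    rw [Submodule.mkQ_apply, Submodule.Quotient.mk_eq_zero] at h
    exact hφW' h
  have hq₁QU : π.mkQ ⟨φ, hφW⟩ ∈ QU := by
    refine Submodule.mem_inf.2
      ⟨(σ.mem_fixedPoints Uv _).2 fun u hu => ?_, (π.finiteRep.mem_fixedPoints C _).2 fun c hc => ?_⟩
    · rw [Submodule.mkQ_apply, π.localRep_mk v σ hσ]
      congr 1
      refine Subtype.ext ?_
      change rightTranslation (AdelicGroupData.gl n K) (GLn.ofLocal n K v u) φ = φ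
      rw [← GLn.ofFinite_sndHom_ofLocal v]
      exact hU₁fix _ (Subgroup.mem_inf.1 hu).1
    · obtain ⟨u, hu, hcu⟩ := ((hmemC c).1 hc).1
      rw [Submodule.mkQ_apply, π.finiteRep_mk]
      congr 1
      refine Subtype.ext ?_
      change rightTranslation (AdelicGroupData.gl n K) (c : (AdelicGroupData.gl n K).Adelic) φ = φ
      rw [← hcu]
      exact hU₁fix _ hu
  exact ⟨Uv, QU, hQUk, hUvcpt, fun h => hq₁ ((Submodule.eq_bot_iff QU).1 h _ hq₁QU),
    fun q hq => (Submodule.mem_inf.1 hq).1,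
    IsAdmissibleGK.of_injective hadmU'
      ⟨Submodule.inclusion hQU_le, fun k => LinearMap.ext fun q => rfl⟩
      (Submodule.inclusion_injective hQU_le),
    fun g q hq U hU hfix => by
      haveI := hU
      exact π.subgroupQuotientSum_mem_block v σ hσ Uv C hC g hq U hfix⟩

end LocalRep

/-! ### 4. Assembly -/

/-- **Local components of Borel–Jacquet automorphic representations exist, given admissibility**
(reduction of the named fact `AutomorphicRepData.exists_hasLocalComponentAt n K hcpt` to the
named fact `automorphicRep_isAdmissible hcpt` of `LangAutomorphicForms`, Borel–Jacquet 1979, 4.5).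
For an automorphic representation `π = W / W'` of `GL_n(𝔸_K)` and a finite place `v`, the
restriction of `W / W'` to `GL_n(K_v)` (along `ι_v = GLn.ofLocal`) contains an irreducible
`GL_n(K_v)`-stable subspace `V₁` on which the action is smooth; `(V₁, σ|V₁)` is the local
component, the map of `HasLocalComponentAt` being the inclusion `V₁ ≤ W / W'` composed with a
linear section of `W → W / W'`. The subspace comes from the abstract criterion
`exists_irreducible_stable_of_finiteDimensional_heckeStable` applied to the finite-dimensional
Hecke-stable block of `exists_finiteDimensional_heckeStable_block` inside the admissible block
`exists_admissible_block` (where admissibility of `(W / W')^{U'}` for levels `U'`, i.e. the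
hypothesis, enters), the irreducibility of `W / W'` under `GL_n(K_v)`, `{c_v = 1}`, `K_∞`, `𝔤`
(`quot_eq_bot_or_eq_top_of_stable`) and the smoothness of the `GL_n(𝔸_K^∞)`-action (the other
half of the hypothesis, with `GLn.continuous_ofLocal`). Printed source of the fact: Flath,
Corvallis 1979, Thm. 3 (an irreducible admissible representation of the global Hecke algebra is
a restricted tensor product `⊗'_v π_v` of irreducible admissible local representations) and
Thm. 4 (the factors of an admissible irreducible representation of `G(𝔸)`), as stated for
`GL(n, 𝔸)` in Bump 1997, Thm. 3.3.3; Borel–Jacquet 1979, §4.6. The proof here does not use the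
tensor product theorem. [cite: FlathCorvallis1979, Thm. 3 and Thm. 4] -/
theorem exists_hasLocalComponentAt_of_isAdmissible (hadm : automorphicRep_isAdmissible hcpt) :
    exists_hasLocalComponentAt n K hcpt := by
  intro π v
  -- the local embedding and the action `σ` of `GL_n(K_v)` on `W / W'`
  let ι : GL (Fin n) (v.adicCompletion K) →* (AdelicGroupData.gl n K).Adelic := GLn.ofLocal n K v
  have hιmem : ∀ t, ι t ∈ (AutomorphyDatum.gl n K hcpt).finiteAdelic := fun t =>
    GLn.ofLocal_mem_range_ofFinite v t
  let ι' : GL (Fin n) (v.adicCompletion K) →* (AutomorphyDatum.gl n K hcpt).finiteAdelic :=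
    ι.codRestrict _ hιmem
  have hι'cont : Continuous ι' := (GLn.continuous_ofLocal n K v).subtype_mk hιmem
  let σ : Representation ℂ (GL (Fin n) (v.adicCompletion K)) π.Quot := π.finiteRep.comp ι'
  have hσ : ∀ t, σ t = π.finiteRep ⟨GLn.ofLocal n K v t, GLn.ofLocal_mem_range_ofFinite v t⟩ :=
    fun t => rfl
  have hσ_mk : ∀ (t : GL (Fin n) (v.adicCompletion K)) (ψ : π.W),
      σ t (Submodule.Quotient.mk ψ) = Submodule.Quotient.mk (p := π.kerQuot)
        ⟨rightTranslation (AdelicGroupData.gl n K) (ι t) ψ,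
          π.stable.finite_stable _ (hιmem t) ψ.2⟩ := fun _ _ => rfl
  -- `σ` is smooth (smoothness of `π.finiteRep`, continuity of `ι`)
  have hσsm : ∀ q : π.Quot, σ.IsSmoothVector q := fun q =>
    σ.isSmoothVector_of_le (K := (π.finiteRep.stabilizerSubgroup q).comap ι')
      (((hadm π).1 q).preimage hι'cont) fun g hg => hg
  -- the extra operators on `W / W'`: `r(c)` (`c_v = 1`), `r(k)` (`k ∈ K_∞`), `X ∈ 𝔤`
  let 𝓔 : Set (Module.End ℂ π.Quot) :=
    ({E | ∃ c : (AutomorphyDatum.gl n K hcpt).finiteAdelic,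
        (AdelicGroupData.gl n K).toLocal v c = 1 ∧ E = π.finiteRep c} ∪
      {E | ∃ k : (AutomorphyDatum.gl n K hcpt).arch.maximalCompact, E = π.kRep k}) ∪
      {E | ∃ X : (AutomorphyDatum.gl n K hcpt).arch.lie, E = π.lieRep X}
  have hcommk : ∀ (k : (AutomorphyDatum.gl n K hcpt).arch.maximalCompact) (t) (q : π.Quot),
      π.kRep k (σ t q) = σ t (π.kRep k q) := fun k t q => π.kRep_comm_finiteRep k (ι' t) q
  have hEcomm : ∀ E ∈ 𝓔, ∀ t, E * σ t = σ t * E := by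
    rintro E ((⟨c, hc, rfl⟩ | ⟨k, rfl⟩) | ⟨X, rfl⟩) t
    · exact LinearMap.ext fun q => π.finiteRep_localRep_comm v σ hσ c hc t q
    · exact LinearMap.ext fun q => hcommk k t q
    · exact LinearMap.ext fun q => π.lieRep_comm_finiteRep X (ι' t) q
  have hirrQ : ∀ P : Submodule ℂ π.Quot, (∀ t, ∀ q ∈ P, σ t q ∈ P) →
      (∀ E ∈ 𝓔, ∀ q ∈ P, E q ∈ P) → P = ⊥ ∨ P = ⊤ := fun P hPσ hPE =>
    π.quot_eq_bot_or_eq_top_of_stable v P (fun t q hq => hPσ t q hq)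
      (fun c hc q hq => hPE _ (Or.inl (Or.inl ⟨c, hc, rfl⟩)) q hq)
      (fun k q hq => hPE _ (Or.inl (Or.inr ⟨k, rfl⟩)) q hq)
      (fun X q hq => hPE _ (Or.inr ⟨X, rfl⟩) q hq)
  -- the admissible block at `v`, a finite-dimensional Hecke-stable block inside it
  obtain ⟨Uv, QU, hQUk, hUvcpt, hQU0, hQUfix, hadmQU, hQUsum⟩ :=
    π.exists_admissible_block v σ hσ hadm
  have hsm : ∀ q : π.Quot, ∃ U : Subgroup Uv, U.FiniteIndex ∧
      ∀ u : Uv, u ∈ U → σ (u : GL (Fin n) (v.adicCompletion K)) q = q := fun q =>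
    exists_finiteIndex_forall_apply_eq_of_isSmoothVector σ Uv hUvcpt (hσsm q)
  obtain ⟨q₁, hq₁QU, hq₁⟩ := Submodule.exists_mem_ne_zero_of_ne_bot hQU0
  obtain ⟨F, hFfin, hF0, hFQU, hF⟩ :=
    exists_finiteDimensional_heckeStable_block σ Uv π.kRep hcommk hsm QU hQUk hQUsum hadmQU
      hq₁ hq₁QU (π.finiteDimensional_span_kRep q₁)
  haveI := hFfin
  -- the irreducible smooth local component `V₁ ≤ W / W'`
  obtain ⟨V₁, hV₁0, hV₁σ, hV₁irr⟩ :=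
    exists_irreducible_stable_of_finiteDimensional_heckeStable σ Uv 𝓔 hEcomm hirrQ hsm F hF0
      (fun x hx => hQUfix (hFQU hx)) hF
  obtain ⟨hirr₁, hsm₁⟩ := isIrreducible_and_isSmooth_subrepresentation σ hσsm V₁ hV₁0 hV₁σ hV₁irr
  let πv : SmoothIrrep (GL (Fin n) (v.adicCompletion K)) :=
    { V := V₁
      ρ := σ.subrepresentation V₁ fun g x hx => hV₁σ g x hx
      isIrreducible := hirr₁
      isSmooth := hsm₁ }
  refine ⟨πv, ?_⟩
  -- the lift `V₁ → W / W' → W ⊆ (GL_n(𝔸_K) → ℂ)` along a linear section of `W → W / W'`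
  obtain ⟨s, hs⟩ := π.mkQ.exists_rightInverse_of_surjective (Submodule.range_mkQ _)
  have hs' : ∀ q : π.Quot, π.mkQ (s q) = q := fun q => LinearMap.congr_fun hs q
  refine ⟨π.W.subtype ∘ₗ s ∘ₗ V₁.subtype, ?_, ?_, ?_⟩
  · rintro _ ⟨x, rfl⟩
    exact (s (x : π.Quot)).2
  · intro hle
    obtain ⟨x, hxV₁, hx0⟩ := Submodule.exists_mem_ne_zero_of_ne_bot hV₁0
    have hmem : ((s x : π.W) : (AdelicGroupData.gl n K).Adelic → ℂ) ∈ π.W' :=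
      hle ⟨⟨x, hxV₁⟩, rfl⟩
    refine hx0 ?_
    rw [← hs' x, Submodule.mkQ_apply, Submodule.Quotient.mk_eq_zero]
    exact hmem
  · intro g x
    have h1 : π.mkQ (s (σ g (x : π.Quot))) =
        Submodule.Quotient.mk (p := π.kerQuot)
          ⟨rightTranslation (AdelicGroupData.gl n K) (ι g) (s (x : π.Quot) : π.W),
            π.stable.finite_stable _ (hιmem g) (s (x : π.Quot)).2⟩ := by
      rw [hs', ← hσ_mk g (s (x : π.Quot)), ← Submodule.mkQ_apply, hs']
    rw [Submodule.mkQ_apply, Submodule.Quotient.eq] at h1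
    exact h1

end AutomorphicRepData

end Literature.NumberTheory.Automorphic

end
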